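import Summits.QuantumFields.YangMills.Theorems.PoincareLipschitzKnitFlatPackage
import Summits.QuantumFields.YangMills.Theorems.PoincareLipschitzKnitFlatEndgame
import Summits.QuantumFields.YangMills.Theorems.PoincareLipschitzKnitScaleLetters
import Summits.QuantumFields.YangMills.Theorems.PoincareLipschitzRegaugeAbsorption
import Summits.QuantumFields.YangMills.Theorems.PoincareLipschitzChartsOfOrbitMinHolderRegularity
import Literature.MathematicalPhysics.QuantumFieldTheory.Balaban1983to89.T4PairDerivBridge
import Summits.QuantumFields.YangMills.Theorems.PoincareLipschitzSphereMapOneStepHC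
import Literature.NumberTheory.LFunctions.MatomakiRadziwillTaoMajorArc
import HarnessLib

/-!
# Crux `HistoryTailL` (stmt-QuantumFields-19936), K2 face v2 `hRegH` (route crux `PoincareLipschitz.BlockLipschitzL`, stmt-QuantumFields-23533) —
# THE FINAL KNIT, FILE K-3: `hRegH ⟸ hImprove ∧ hC` BY KERNEL — the Hölder socket of the K2 face v2 (FROZEN 20ad198c, the hypothesis of
# ✓`blockLipschitzL_of_orbitMinHolderRegularity`, VERBATIM) from the organ `hImprove` (v1 899858e5) and the displayed [C]-socket `hC` (2e0c4712); hence
# `BlockLipschitzL ⟸ hImprove ∧ hC` BY NAME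

Cell `ym3-torus` (YM ladder rung R3 = continuum SU(2) Yang–Mills on T³ — a RUNG, NOT the Clay problem: not d = 4, not infinite volume, not a mass gap);
LEAD seat `ym-ust-19936-w1` g9 (bus 2026-08-29T06:26:40Z «OWN PEN: THE FINAL KNIT», RULINGS g9-1…g9-6; ★w2 g11's `K2-FINAL-KNIT-RECIPE` with the two
corrections of g9-2∕g9-3).  Helper `--supports stmt-QuantumFields-19936`; THEOREMS ONLY (0 `def`, 0 `sorry`); the two displayed hypotheses are written out.
COMPOSITION: K-1 ✓`PoincareLipschitzKnitFlatPackage.flatPackage_at_prefix` (the torus orbit minimiser's flat shadow carries every input row of `hImprove` and the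
bond) ∘ K-2b ✓`PoincareLipschitzKnitFlatEndgame.bond_sq_le_of_hImprove_of_oneStep` (the flat end-game: `bond² ≤ Λf(r⁻¹ + τ₀)`) ∘ ★w7 g12
✓`PoincareLipschitzKnitScaleLetters.face_of_min_radius` ∕ `two_mul_sqrt_sqrt_le` ∕ `theta_mul_sq_min_le` (the face algebra at `R′ = min R (c∕√θ)`), with the
small-box branch by lit ✓`T4PairDerivBridge.dist1_le_two_specialUnitaryGroup` ∘ ✓`dist1_mul_inv_eq_norm_pertVar`; the corollary imports ★w2 g11's face door
✓`PoincareLipschitzChartsOfOrbitMinHolderRegularity` (p700641).  NOTHING here proves `hImprove` (the K2 residue of record — «energy improvement at bounded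
normalised energy for lattice minimisers into S³», not in print even in the continuum without compactness) — the K2 face, hence
`BlockLipschitzL`, hence (with K1-exp and `MeanDeviationL`, ✓p700135) `HistoryTailL`, are CONDITIONAL on it; the [C]-socket `hC` IS a tree theorem
(★w5 g12 ✓p705854 `hOneStep_holds`) and is discharged here.

THE GEOMETRY OF THE KNIT.  At `hRegH`'s prefix fix `θ = θBal F.L γ b₀ p₀ (K−i) > 0` (`γ ≤ γ₃ := 1`) and the chart radius `R′ := min R (c∕√θ)`, `c := √(min c₁ 1)`
(`c₁` the twist allowance of K-2b), so `θR′² ≤ c² ≤ c₁`.  MAIN BRANCH `R′ ≥ Rbig := 12R₁ + 150`: K1 box side `n := ⌊R′∕3⌋₊ ≥ 20`, flat radius `r := n∕4 − 4`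
(`1 ≤ r`, `r + 4 ≤ n∕2`, `4r ≤ n ≤ 4r + 19`, `R₁ ≤ r`, `r⁻¹ ≤ 24∕R′`); K-1 gives the package with `τ₀ = 8(n−1)θ` (`τ₀r ≤ 2n²θ ≤ (2∕9)θR′² ≤ c₁`, `τ₀ ≤ 3θR′`)
and energy `18n³((n∕2−r−3)⁻² + (8(n−1)θ)²) ≤ 7272·r` (§1 `energy_row_le`: `4(n∕2−r−3) ≥ n+1`, `n²θ ≤ 1∕9`); K-2b at `Λ₀ := 7272` gives
`‖pertVar‖² ≤ Λf(r⁻¹ + τ₀) ≤ 72Λf(R′⁻¹ + θR′)`, so `‖pertVar‖ ≤ √(72Λf)((√R′)⁻¹ + √θ√R′) ≤ √(72Λf)((√c)⁻¹ + 1)((√R)⁻¹ + √θ√R)` (§1 `face_of_bond_sq`,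
✓`face_of_min_radius`).  SMALL BRANCH `R′ < Rbig`: `‖pertVar‖ ≤ 2 ≤ Λ((√R)⁻¹ + √θ√R)` (§1 `two_le_face_of_small`: either `R < Rbig` and `(√R)⁻¹ ≥ (√Rbig)⁻¹`,
or `c∕√θ < Rbig` and `2√(√θ) ≥ 2√(c∕Rbig)` by ✓`two_mul_sqrt_sqrt_le`).  `Λ := √(72Λf)((√c)⁻¹+1) + 2√Rbig + √(Rbig∕c) + 1` — ABSOLUTE (the organ's and the
socket's constants only), as `hRegH` requires (`∃ Λ` right after `∀ L`).

WHAT IS PROVED (ns `…Theorems.PoincareLipschitzOrbitMinHolderRegularityOfImprove`).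
* §1 letters: `face_of_bond_sq` (via lit ✓`MRT2015.sqrt_add_le_sqrt_add_sqrt`), `two_le_face_of_small`, `boxRadius_facts` (ℕ), `energy_row_le`.
* §2 ★★★ `hRegH_of_hImprove_of_oneStep (hI : ⟨hImprove v1⟩) (hC : ⟨hC⟩) : ⟨hRegH, K2 face v2 20ad198c VERBATIM⟩` (the knit proper);
  ★★★ `hRegH_of_hImprove (hI) : ⟨hRegH⟩` — `hC` discharged by ★w5 g12's ✓`PoincareLipschitzSphereMapOneStepHC.hOneStep_holds` (p705854);
  ★★★ `blockLipschitzL_of_hImprove (hI) : Summit.QuantumFields.YangMills.Theses.PoincareLipschitz.BlockLipschitzL` (BY NAME).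
HONEST SCOPE.  A composition; CONDITIONAL on the organ `hImprove` only.  YM₃ on T³ is rung R3, not Clay; YM gap NOT proved; `HistoryTailL` NOT proved.

References: T. Bałaban, CMP 109 (1987) 249–301 [Balaban1987RG1] ((0.14), (0.18) pp.254–255); CMP 98 (1985) 17–51 [Balaban1985Averaging] ((19)–(20) p.21);
R. Schoen, K. Uhlenbeck, J. Diff. Geom. 17 (1982) 307–335 [SchoenUhlenbeck1982] (§4, Thm IV); Y. L. Xin, Duke Math. J. 47 (1980) 609–613 [Xin1980].
-/

set_option autoImplicit false

noncomputable section

open scoped BigOperators InnerProductSpace Matrix.Norms.L2Operator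
open Finset

namespace Summit.QuantumFields.YangMills.Theorems.PoincareLipschitzOrbitMinHolderRegularityOfImprove

open Literature.MathematicalPhysics.QuantumFieldTheory.Balaban1983to89
open Literature.MathematicalPhysics.QuantumFieldTheory.Balaban1983to89.T3ContinuumYM3Torus
open Literature.MathematicalPhysics.QuantumFieldTheory.Balaban1983to89.T3MinimiserStabilityReduction (θBal_pos)
open Literature.MathematicalPhysics.QuantumFieldTheory.Balaban1983to89.T4PairDerivBridge (dist1_le_two_specialUnitaryGroup)
open B4Eq19LatticeOperators (Zd box unitVec)
open Summit.QuantumFields.YangMills.Theorems.PoincareLipschitzKnitFlatPackage (flatPackage_at_prefix)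
open Summit.QuantumFields.YangMills.Theorems.PoincareLipschitzKnitFlatEndgame (bond_sq_le_of_hImprove_of_oneStep)
open Summit.QuantumFields.YangMills.Theorems.PoincareLipschitzKnitScaleLetters (face_of_min_radius two_mul_sqrt_sqrt_le theta_mul_sq_min_le)
open Summit.QuantumFields.YangMills.Theorems.PoincareLipschitzRegaugeAbsorption (dist1_mul_inv_eq_norm_pertVar)
open Summit.QuantumFields.YangMills.Theorems.PoincareLipschitzChartsOfOrbitMinHolderRegularity (blockLipschitzL_of_orbitMinHolderRegularity)
open Summit.QuantumFields.YangMills.Theorems (PoincareLipschitzSphereMapOneStepHC.hOneStep_holds)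
open Literature.NumberTheory.LFunctions.MRT2015 (sqrt_add_le_sqrt_add_sqrt)

/-! ## §1 Real letters of the knit -/

/-- **FROM THE FLAT BOND TO THE FACE**: `X² ≤ Λf·(r⁻¹ + τ₀)`, `r⁻¹ ≤ 24∕R′`, `τ₀ ≤ 3θR′` ⟹ `X ≤ √(72Λf)·((√R′)⁻¹ + √θ·√R′)`. [folklore] -/
theorem face_of_bond_sq {X Λf r τ₀ R' θ : ℝ} (hX : 0 ≤ X) (hΛ : 0 ≤ Λf) (hR' : 0 < R') (hθ : 0 ≤ θ) (hτ0 : 0 ≤ τ₀)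
    (hsq : X ^ 2 ≤ Λf * (r⁻¹ + τ₀)) (hrR : r⁻¹ ≤ 24 / R') (hτ : τ₀ ≤ 3 * (θ * R')) :
    X ≤ Real.sqrt (72 * Λf) * ((Real.sqrt R')⁻¹ + Real.sqrt θ * Real.sqrt R') := by
  have h1 : X ^ 2 ≤ 72 * Λf * (R'⁻¹ + θ * R') := by
    have : r⁻¹ + τ₀ ≤ 72 * (R'⁻¹ + θ * R') := by
      rw [div_eq_mul_inv] at hrR
      nlinarith [inv_pos.mpr hR', mul_nonneg hθ hR'.le]
    nlinarith [mul_le_mul_of_nonneg_left this hΛ]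
  have h2 : X ≤ Real.sqrt (72 * Λf * (R'⁻¹ + θ * R')) := by
    rw [← Real.sqrt_sq hX]; exact Real.sqrt_le_sqrt h1
  have h3 : Real.sqrt (72 * Λf * (R'⁻¹ + θ * R')) = Real.sqrt (72 * Λf) * Real.sqrt (R'⁻¹ + θ * R') := Real.sqrt_mul (by positivity) _
  have h4 : Real.sqrt (R'⁻¹ + θ * R') ≤ (Real.sqrt R')⁻¹ + Real.sqrt θ * Real.sqrt R' := by
    have := sqrt_add_le_sqrt_add_sqrt (inv_pos.mpr hR').le (mul_nonneg hθ hR'.le)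
    rwa [Real.sqrt_inv, Real.sqrt_mul hθ] at this
  calc X ≤ Real.sqrt (72 * Λf) * Real.sqrt (R'⁻¹ + θ * R') := by rw [← h3]; exact h2
    _ ≤ Real.sqrt (72 * Λf) * ((Real.sqrt R')⁻¹ + Real.sqrt θ * Real.sqrt R') := mul_le_mul_of_nonneg_left h4 (Real.sqrt_nonneg _)

/-- **THE SMALL-BOX BRANCH**: if `R′ = min R (c∕√θ) < Rbig` then `2 ≤ Λ·((√R)⁻¹ + √θ√R)` as soon as `Λ ≥ 2√Rbig` and `Λ ≥ √(Rbig∕c)`. [folklore] -/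
theorem two_le_face_of_small {R θ c Rbig Λ : ℝ} (hR : 0 < R) (hθ : 0 < θ) (hc : 0 < c) (hRbig : 1 ≤ Rbig) (hΛ0 : 0 ≤ Λ)
    (hΛ1 : 2 * Real.sqrt Rbig ≤ Λ) (hΛ2 : Real.sqrt (Rbig / c) ≤ Λ) (hsmall : min R (c / Real.sqrt θ) < Rbig) :
    2 ≤ Λ * ((Real.sqrt R)⁻¹ + Real.sqrt θ * Real.sqrt R) := by
  have hsθ : 0 < Real.sqrt θ := Real.sqrt_pos.mpr hθ
  have hsR : 0 < Real.sqrt R := Real.sqrt_pos.mpr hR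
  have hface0 : 0 ≤ (Real.sqrt R)⁻¹ + Real.sqrt θ * Real.sqrt R := by positivity
  rcases min_lt_iff.mp hsmall with h | h
  · -- `R < Rbig`: `(√R)⁻¹ ≥ (√Rbig)⁻¹`
    have h1 : (Real.sqrt Rbig)⁻¹ ≤ (Real.sqrt R)⁻¹ := by
      refine inv_anti₀ hsR (Real.sqrt_le_sqrt h.le)
    have hsB : 0 < Real.sqrt Rbig := Real.sqrt_pos.mpr (by linarith)
    have h2 : 2 ≤ Λ * (Real.sqrt Rbig)⁻¹ := by
      rw [← div_eq_mul_inv, le_div_iff₀ hsB]; linarith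
    calc (2 : ℝ) ≤ Λ * (Real.sqrt Rbig)⁻¹ := h2
      _ ≤ Λ * (Real.sqrt R)⁻¹ := mul_le_mul_of_nonneg_left h1 hΛ0
      _ ≤ Λ * ((Real.sqrt R)⁻¹ + Real.sqrt θ * Real.sqrt R) := by
          refine mul_le_mul_of_nonneg_left ?_ hΛ0
          have : 0 ≤ Real.sqrt θ * Real.sqrt R := by positivity
          linarith
  · -- `c∕√θ < Rbig`: `√θ > c∕Rbig`, face `≥ 2√(√θ) ≥ 2√(c∕Rbig)`
    have h1 : c / Rbig < Real.sqrt θ := by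
      rw [div_lt_iff₀ (by linarith)]; rw [div_lt_iff₀ hsθ] at h; linarith
    have h2 : Real.sqrt (c / Rbig) ≤ Real.sqrt (Real.sqrt θ) := Real.sqrt_le_sqrt h1.le
    have h3 := two_mul_sqrt_sqrt_le θ hR
    have hcB : 0 < c / Rbig := by positivity
    have h4 : Real.sqrt (Rbig / c) * Real.sqrt (c / Rbig) = 1 := by
      rw [← Real.sqrt_mul (by positivity)]; rw [show Rbig / c * (c / Rbig) = 1 by field_simp]; simp
    have h5 : 1 ≤ Λ * Real.sqrt (c / Rbig) := by
      calc (1 : ℝ) = Real.sqrt (Rbig / c) * Real.sqrt (c / Rbig) := h4.symm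
        _ ≤ Λ * Real.sqrt (c / Rbig) := mul_le_mul_of_nonneg_right hΛ2 (Real.sqrt_nonneg _)
    calc (2 : ℝ) ≤ 2 * (Λ * Real.sqrt (c / Rbig)) := by linarith
      _ = Λ * (2 * Real.sqrt (c / Rbig)) := by ring
      _ ≤ Λ * (2 * Real.sqrt (Real.sqrt θ)) := mul_le_mul_of_nonneg_left (by linarith) hΛ0
      _ ≤ Λ * ((Real.sqrt R)⁻¹ + Real.sqrt θ * Real.sqrt R) := mul_le_mul_of_nonneg_left h3 hΛ0

/-- **THE INTEGER GEOMETRY OF THE K1 BOX** (`n = ⌊R′∕3⌋₊ ≥ 20`, `r = n∕4 − 4`): `1 ≤ r`, `r + 4 ≤ n∕2`, `4r + 19 ≥ n`, `4r ≤ n`, and the plateau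
margin `4·(n∕2 − r − 3) ≥ n + 1`. [folklore] -/
theorem boxRadius_facts {n : ℕ} (hn : 20 ≤ n) :
    1 ≤ n / 4 - 4 ∧ n / 4 - 4 + 4 ≤ n / 2 ∧ n ≤ 4 * (n / 4 - 4) + 19 ∧ 4 * (n / 4 - 4) ≤ n ∧ n + 1 ≤ 4 * (n / 2 - (n / 4 - 4) - 3) := by
  omega

/-- **THE ENERGY ROW IN THE BOX**: `18n³((1∕s)² + (8(n−1)θ)²) ≤ 7272·r` when `4s ≥ n + 1`, `n ≤ 4r + 19`, `1 ≤ r`, `n ≥ 20`, `n²θ ≤ 1∕9`. [folklore] -/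
theorem energy_row_le {n s r θ : ℝ} (hn : 20 ≤ n) (hs : n + 1 ≤ 4 * s) (hr : n ≤ 4 * r + 19) (hr1 : 1 ≤ r) (hθ : 0 ≤ θ) (hnθ : n ^ 2 * θ ≤ 1 / 9) :
    18 * n ^ 3 * ((1 / s) ^ 2 + (8 * (n - 1) * θ) ^ 2) ≤ 7272 * r := by
  have hs0 : 0 < s := by linarith
  have hn0 : 0 < n := by linarith
  have h1 : (1 / s) ^ 2 ≤ 16 / n ^ 2 := by
    rw [div_pow, one_pow, div_le_div_iff₀ (by positivity) (by positivity)]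
    nlinarith
  have h2 : 18 * n ^ 3 * (1 / s) ^ 2 ≤ 288 * n := by
    calc 18 * n ^ 3 * (1 / s) ^ 2 ≤ 18 * n ^ 3 * (16 / n ^ 2) := mul_le_mul_of_nonneg_left h1 (by positivity)
      _ = 288 * n := by field_simp; norm_num
  have h3 : 18 * n ^ 3 * (8 * (n - 1) * θ) ^ 2 ≤ 15 * n := by
    have h30 : 0 ≤ (n - 1) * θ := mul_nonneg (by linarith) hθ
    have h30' : (n - 1) * θ ≤ n * θ := mul_le_mul_of_nonneg_right (by linarith) hθ
    have h31 : (8 * (n - 1) * θ) ^ 2 ≤ 64 * (n * θ) ^ 2 := by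
      have := pow_le_pow_left₀ h30 h30' 2
      calc (8 * (n - 1) * θ) ^ 2 = 64 * ((n - 1) * θ) ^ 2 := by ring
        _ ≤ 64 * (n * θ) ^ 2 := by linarith
    have h32 : 18 * n ^ 3 * (64 * (n * θ) ^ 2) = 1152 * n * (n ^ 2 * θ) ^ 2 := by ring
    have h33 : (n ^ 2 * θ) ^ 2 ≤ (1 / 9) ^ 2 := pow_le_pow_left₀ (by positivity) hnθ 2
    calc 18 * n ^ 3 * (8 * (n - 1) * θ) ^ 2 ≤ 18 * n ^ 3 * (64 * (n * θ) ^ 2) := mul_le_mul_of_nonneg_left h31 (by positivity)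
      _ = 1152 * n * (n ^ 2 * θ) ^ 2 := h32
      _ ≤ 1152 * n * (1 / 9) ^ 2 := mul_le_mul_of_nonneg_left h33 (by positivity)
      _ ≤ 15 * n := by nlinarith
  nlinarith

/-! ## §2 ★★★ The knit -/

set_option maxHeartbeats 800000 in
/-- ★★★ **THE KNIT: `hRegH ⟸ hImprove ∧ hC`.**  The organ `hImprove` (v1 899858e5, VERBATIM) and the [C]-socket `hC` (2e0c4712, VERBATIM) imply the
Hölder socket `hRegH` of the K2 face v2 (FROZEN 20ad198c, VERBATIM = the hypothesis of ✓`blockLipschitzL_of_orbitMinHolderRegularity`): for every `L`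
an ABSOLUTE `Λ` such that at every bond `b` with room `R` of the reading set, for every box-`ℓ²`-orbit minimiser `h`,
`‖pertVar (ŪⁱU) ((ŪⁱU′)^h) b‖ ≤ Λ((√R)⁻¹ + √θ_i·√R)`.  K-1 ∘ K-2b ∘ the face algebra, as in the file header.
[cite: Balaban1987RG1, (0.14) p.254; SchoenUhlenbeck1982, §4; Xin1980, §1] -/
theorem hRegH_of_hImprove_of_oneStep
    (hI : ∀ (Λ₀ ε₀ κ : ℝ), 0 < Λ₀ → 0 < ε₀ → 1 ≤ κ →
      ∃ (C₀ R₀ : ℝ), 1 ≤ C₀ ∧ 1 ≤ R₀ ∧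
      ∀ (u : Zd 3 → EuclideanSpace ℝ (Fin 4)) (τ : Fin 3 → Zd 3 → (EuclideanSpace ℝ (Fin 4) ≃ₗᵢ[ℝ] EuclideanSpace ℝ (Fin 4)))
      (z : Zd 3) (R : ℤ) (τ₀ : ℝ),
      R₀ ≤ R →
      (∀ y, ‖u y‖ = 1) →
      (∀ y ∈ box z (R + 1), ∀ (μ : Fin 3) (w : EuclideanSpace ℝ (Fin 4)), ‖τ μ y w - w‖ ≤ τ₀ * ‖w‖) →
      τ₀ * (R : ℝ) ≤ C₀⁻¹ →
      (∀ y ∈ box z R,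
      ‖∑ μ : Fin 3, (τ μ y (u (y + unitVec μ)) + (τ μ (y - unitVec μ)).symm (u (y - unitVec μ)))‖ • u y =
      ∑ μ : Fin 3, (τ μ y (u (y + unitVec μ)) + (τ μ (y - unitVec μ)).symm (u (y - unitVec μ)))) →
      (∀ (z' : Zd 3) (R' : ℤ), 0 ≤ R' → box z' (R' + 1) ⊆ box z R →
      ∀ v : Zd 3 → EuclideanSpace ℝ (Fin 4), (∀ y, y ∉ box z' R' → v y = u y) → (∀ y ∈ box z' R', ‖v y‖ = 1) →
      ∑ y ∈ box z' (R' + 1), ∑ μ : Fin 3, ‖τ μ y (u (y + unitVec μ)) - u y‖ ^ 2 ≤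
      ∑ y ∈ box z' (R' + 1), ∑ μ : Fin 3, ‖τ μ y (v (y + unitVec μ)) - v y‖ ^ 2) →
      (∑ y ∈ box z R, ∑ μ : Fin 3, ‖τ μ y (u (y + unitVec μ)) - u y‖ ^ 2 ≤ Λ₀ * R) →
      ∃ r : ℤ, 1 ≤ r ∧ (R : ℝ) ≤ C₀ * Real.log R ^ 6 * r ∧ κ * Real.log R ^ 6 * r ≤ R ∧
      box z (2 * r) ⊆ box z R ∧
      (∑ y ∈ box z (2 * r), ∑ μ : Fin 3, ‖τ μ y (u (y + unitVec μ)) - u y‖ ^ 2) * Real.log r ^ 6 ≤ ε₀ * r)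
    (hC : ∃ A : ℝ, 0 ≤ A ∧ ∀ ε : ℝ, 0 < ε → ∃ ε₁ : ℝ, 0 < ε₁ ∧
      ∀ (u : Zd 3 → EuclideanSpace ℝ (Fin 4)) (x : Zd 3) (r : ℤ) (sl : ℝ), 0 ≤ sl →
      (∀ y, ‖u y‖ = 1) →
      (∀ w : Zd 3 → EuclideanSpace ℝ (Fin 4), (∀ y, ‖w y‖ = 1) → (∀ y, y ∉ box x (r - 1) → w y = u y) →
      ∑ y ∈ box x r, ∑ μ : Fin 3, ‖u (y + unitVec μ) - u y‖ ^ 2 ≤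
      (∑ y ∈ box x r, ∑ μ : Fin 3, ‖w (y + unitVec μ) - w y‖ ^ 2) + sl) →
      (∑ y ∈ box x r, ∑ μ : Fin 3, ‖u (y + unitVec μ) - u y‖ ^ 2) * (1 + Real.log r) ^ 6 ≤ ε₁ * r →
      ∀ ρ : ℤ, 1 ≤ ρ → ρ + 1 ≤ r →
      ∑ y ∈ box x ρ, ∑ μ : Fin 3, ‖u (y + unitVec μ) - u y‖ ^ 2 ≤
      (A * (((ρ : ℝ) + 1) / r) ^ 3 + ε) * (∑ y ∈ box x r, ∑ μ : Fin 3, ‖u (y + unitVec μ) - u y‖ ^ 2) + 2 * sl) :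
    open Literature.MathematicalPhysics.QuantumFieldTheory.Balaban1983to89 Literature.MathematicalPhysics.QuantumFieldTheory.Balaban1983to89.T3ContinuumYM3Torus in ∀ (L : ℕ), ∃ Λ : ℝ, 0 < Λ ∧ ∀ (b₀ p₀ : ℝ), 0 < b₀ → 2 < p₀ → ∃ γ₃ : ℝ, 0 < γ₃ ∧ ∀ (F : T3Family) (γ : ℝ), F.L = L → 0 < γ → γ ≤ γ₃ → ∀ (K j : ℕ), 1 ≤ j → j + 3 ≤ K → ∀ (a : Plaq (F.P K) (j + 1)) (U U' : GaugeField (F.P K) 0 (Matrix.specialUnitaryGroup (Fin 2) ℂ)), (∀ (i : ℕ) (q : Plaq (F.P K) i), i < j + 1 → Site.tdist (fun k => ((((q.src k).val * F.L ^ i : ℕ)) : ZMod ((F.P K).sitesPerDir 0))) (fun k => ((((a.src k).val * F.L ^ (j + 1) : ℕ)) : ZMod ((F.P K).sitesPerDir 0))) + 64 * F.L ^ i ≤ 64 * F.L ^ (j + 1) → GaugeGroup.dist1 (GaugeField.plaqHol (Averaging.iter (fun i' => BlockAveraging.blockAvg (P := F.P K) (j := i') T3UnitLawDensityEML.ℰp)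 i U) q) < T3UnitScaleTilt.θBal F.L γ b₀ p₀ (K - i)) → (∀ (i : ℕ) (q : Plaq (F.P K) i), i < j + 1 → Site.tdist (fun k => ((((q.src k).val * F.L ^ i : ℕ)) : ZMod ((F.P K).sitesPerDir 0))) (fun k => ((((a.src k).val * F.L ^ (j + 1) : ℕ)) : ZMod ((F.P K).sitesPerDir 0))) + 64 * F.L ^ i ≤ 64 * F.L ^ (j + 1) → GaugeGroup.dist1 (GaugeField.plaqHol (Averaging.iter (fun i' => BlockAveraging.blockAvg (P := F.P K) (j := i') T3UnitLawDensityEML.ℰp) i U') q) < T3UnitScaleTilt.θBal F.L γ b₀ p₀ (K - i)) → ∀ (i : ℕ), i < j → ∀ (M : ℕ) (h : GaugeTransf (F.P K) i (Matrix.specialUnitaryGroup (Fin 2) ℂ)), (∀ k' : GaugeTransf (F.P K) i (Matrix.specialUnitaryGroup (Fin 2) ℂ), (∑ b : PBond (F.P K) i, if b ∈ Finset.univ.filter (fun b : PBond (F.P K) i => Site.tdist (fun k => ((((b.src k).val * F.L ^ i : ℕ)) : ZMod ((F.P K).sitesPerDir 0))) (fun k => ((((a.src k).val * F.L ^ (j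 + 1) : ℕ)) : ZMod ((F.P K).sitesPerDir 0))) + 2 * F.L ^ (i + 1) + M ≤ 8 * F.L ^ (j + 1)) then GaugeGroup.dist1 (Averaging.iter (fun i' => BlockAveraging.blockAvg (P := F.P K) (j := i') T3UnitLawDensityEML.ℰp) i U b * (GaugeField.gaugeAct h (Averaging.iter (fun i' => BlockAveraging.blockAvg (P := F.P K) (j := i') T3UnitLawDensityEML.ℰp) i U') b)⁻¹) ^ 2 else 0) ≤ ∑ b : PBond (F.P K) i, if b ∈ Finset.univ.filter (fun b : PBond (F.P K) i => Site.tdist (fun k => ((((b.src k).val * F.L ^ i : ℕ)) : ZMod ((F.P K).sitesPerDir 0))) (fun k => ((((a.src k).val * F.L ^ (j + 1) : ℕ)) : ZMod ((F.P K).sitesPerDir 0))) + 2 * F.L ^ (i + 1) + M ≤ 8 * F.L ^ (j + 1)) then GaugeGroup.dist1 (Averaging.iter (fun i' => BlockAveraging.blockAvg (P := F.P K) (j := i') T3UnitLawDensityEML.ℰp) i U b * (GaugeField.gaugeAct k' (GaugeField.gaugeAct h (Averaging.iter (fun i' => BlockAveraging.blockAvg (P := F.P K) (j := i') T3UnitLawDensityEML.ℰp)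 i U')) b)⁻¹) ^ 2 else 0) → ∀ (b : PBond (F.P K) i) (R : ℝ), 1 ≤ R → ((Site.tdist (fun k => ((((b.src k).val * F.L ^ i : ℕ)) : ZMod ((F.P K).sitesPerDir 0))) (fun k => ((((a.src k).val * F.L ^ (j + 1) : ℕ)) : ZMod ((F.P K).sitesPerDir 0))) : ℕ) : ℝ) + R * (F.L : ℝ) ^ i + 2 * (F.L : ℝ) ^ (i + 1) + (M : ℝ) ≤ 8 * (F.L : ℝ) ^ (j + 1) → ‖BlockAveragingEMLLinearisedBackground.pertVar (Averaging.iter (fun i' => BlockAveraging.blockAvg (P := F.P K) (j := i') T3UnitLawDensityEML.ℰp) i U) (GaugeField.gaugeAct h (Averaging.iter (fun i' => BlockAveraging.blockAvg (P := F.P K) (j := i') T3UnitLawDensityEML.ℰp) i U')) b‖ ≤ Λ * ((Real.sqrt R)⁻¹ + Real.sqrt (T3UnitScaleTilt.θBal F.L γ b₀ p₀ (K - i)) * Real.sqrt R) := by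
  -- the flat end-game at `Λ₀ := 7272`
  obtain ⟨Λf, R₁, c₁, hΛf, hR₁, hc₁, hK2⟩ := bond_sq_le_of_hImprove_of_oneStep hI hC 7272 (by norm_num)
  -- absolute constants
  obtain ⟨c, hc_def⟩ : ∃ c : ℝ, c = Real.sqrt (min c₁ 1) := ⟨_, rfl⟩
  have hc0 : 0 < c := by rw [hc_def]; exact Real.sqrt_pos.mpr (lt_min hc₁ one_pos)
  have hc1 : c ≤ 1 := by
    rw [hc_def]
    calc Real.sqrt (min c₁ 1) ≤ Real.sqrt 1 := Real.sqrt_le_sqrt (min_le_right _ _)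
      _ = 1 := Real.sqrt_one
  have hcsq : c ^ 2 ≤ c₁ := by rw [hc_def, Real.sq_sqrt (le_min hc₁.le zero_le_one)]; exact min_le_left _ _
  obtain ⟨Rbig, hRbig_def⟩ : ∃ Rbig : ℝ, Rbig = 12 * R₁ + 150 := ⟨_, rfl⟩
  have hRbig1 : 1 ≤ Rbig := by rw [hRbig_def]; linarith
  obtain ⟨Λ, hΛ_def⟩ : ∃ Λ : ℝ, Λ = Real.sqrt (72 * Λf) * ((Real.sqrt c)⁻¹ + 1) + 2 * Real.sqrt Rbig + Real.sqrt (Rbig / c) + 1 := ⟨_, rfl⟩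
  have hA0 : 0 ≤ Real.sqrt (72 * Λf) * ((Real.sqrt c)⁻¹ + 1) := by positivity
  have hB0 : 0 ≤ Real.sqrt Rbig := Real.sqrt_nonneg _
  have hC0 : 0 ≤ Real.sqrt (Rbig / c) := Real.sqrt_nonneg _
  have hΛa : Real.sqrt (72 * Λf) * ((Real.sqrt c)⁻¹ + 1) ≤ Λ := by rw [hΛ_def]; linarith
  have hΛb : 2 * Real.sqrt Rbig ≤ Λ := by rw [hΛ_def]; linarith
  have hΛc : Real.sqrt (Rbig / c) ≤ Λ := by rw [hΛ_def]; linarith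
  have hΛ0 : 0 < Λ := by rw [hΛ_def]; positivity
  intro L
  refine ⟨Λ, hΛ0, fun b₀ p₀ hb₀ _ => ⟨1, one_pos, ?_⟩⟩
  intro F γ hFL hγ hγ1 K j hj hjK a U U' hwU hwU' i hi M h hmin b R hR1 hroom
  have hL1 : 1 ≤ F.L := by have := F.hL.2; omega
  set θ : ℝ := T3UnitScaleTilt.θBal F.L γ b₀ p₀ (K - i) with hθ_def
  have hθ : 0 < θ := θBal_pos hL1 hγ hγ1 hb₀ p₀ (K - i)
  have hsθ : 0 < Real.sqrt θ := Real.sqrt_pos.mpr hθ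
  have hR0 : 0 < R := by linarith
  have hface0 : 0 ≤ (Real.sqrt R)⁻¹ + Real.sqrt θ * Real.sqrt R := by positivity
  -- the trivial bound `‖pertVar‖ ≤ 2`
  have htriv : ‖BlockAveragingEMLLinearisedBackground.pertVar
      (Averaging.iter (fun i' => BlockAveraging.blockAvg (P := F.P K) (j := i') T3UnitLawDensityEML.ℰp) i U)
      (GaugeField.gaugeAct h (Averaging.iter (fun i' => BlockAveraging.blockAvg (P := F.P K) (j := i') T3UnitLawDensityEML.ℰp) i U')) b‖ ≤ 2 := by
    rw [← dist1_mul_inv_eq_norm_pertVar]; exact dist1_le_two_specialUnitaryGroup _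
  -- the chart radius `R′ = min R (c∕√θ)`
  obtain ⟨R', hR'_def⟩ : ∃ R' : ℝ, R' = min R (c / Real.sqrt θ) := ⟨_, rfl⟩
  have hR'R : R' ≤ R := by rw [hR'_def]; exact min_le_left _ _
  have hR'0 : 0 < R' := by rw [hR'_def]; exact lt_min hR0 (by positivity)
  have hR'θ : θ * R' ^ 2 ≤ c ^ 2 := by rw [hR'_def]; exact theta_mul_sq_min_le hθ hc0.le hR0.le
  by_cases hbig : Rbig ≤ R'
  · -- THE MAIN BRANCH
    -- the K1 box side `n = ⌊R′∕3⌋₊` and the flat radius `r = n∕4 − 4`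
    obtain ⟨n, hn_def⟩ : ∃ n : ℕ, n = ⌊R' / 3⌋₊ := ⟨_, rfl⟩
    have hn3 : 3 * (n : ℝ) ≤ R' := by
      have := Nat.floor_le (show 0 ≤ R' / 3 by positivity); rw [← hn_def] at this; linarith
    have hnlt : R' / 3 < n + 1 := by have := Nat.lt_floor_add_one (R' / 3); rwa [← hn_def] at this
    have hn20R : (20 : ℝ) ≤ n := by rw [hRbig_def] at hbig; linarith
    have hn20 : 20 ≤ n := by exact_mod_cast hn20R
    obtain ⟨hr1, hrn, hr19, hr4, hs4⟩ := boxRadius_facts hn20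
    obtain ⟨r, hr_def⟩ : ∃ r : ℕ, r = n / 4 - 4 := ⟨_, rfl⟩
    rw [← hr_def] at hr1 hrn hr19 hr4 hs4
    have hr1R : (1 : ℝ) ≤ r := by exact_mod_cast hr1
    have hr0 : (0 : ℝ) < r := by linarith
    have hr19R : (n : ℝ) ≤ 4 * r + 19 := by exact_mod_cast hr19
    have hr4R : 4 * (r : ℝ) ≤ n := by exact_mod_cast hr4
    have hroom' : ((Site.tdist (fun k => ((((b.src k).val * F.L ^ i : ℕ)) : ZMod ((F.P K).sitesPerDir 0)))
        (fun k => ((((a.src k).val * F.L ^ (j + 1) : ℕ)) : ZMod ((F.P K).sitesPerDir 0))) : ℕ) : ℝ) + R' * (F.L : ℝ) ^ i +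
        2 * (F.L : ℝ) ^ (i + 1) + (M : ℝ) ≤ 8 * (F.L : ℝ) ^ (j + 1) := by
      have : R' * (F.L : ℝ) ^ i ≤ R * (F.L : ℝ) ^ i := mul_le_mul_of_nonneg_right hR'R (by positivity)
      linarith
    -- the flat-shadow package (K-1)
    obtain ⟨u, τ, z₀, hu, hdefect, hopt', hloc', hE', hbond⟩ :=
      flatPackage_at_prefix F hγ hγ1 hb₀ hi hjK a U U' hwU hwU' M h hmin b hroom' hn3 hr1 hrn
    -- the twist scale `τ₀ = 8(n−1)θ`
    have hn1R : (((n - 1 : ℕ) : ℝ)) = (n : ℝ) - 1 := by rw [Nat.cast_sub (by omega)]; simp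
    have hτ00 : 0 ≤ 8 * (((n - 1 : ℕ) : ℝ)) * θ := by positivity
    have h9n : 9 * (n : ℝ) ^ 2 ≤ R' ^ 2 := by
      have := pow_le_pow_left₀ (by positivity : (0 : ℝ) ≤ 3 * n) hn3 2; nlinarith
    have hn2θ' : (n : ℝ) ^ 2 * θ ≤ c ^ 2 / 9 := by
      have := mul_le_mul_of_nonneg_left h9n hθ.le
      rw [le_div_iff₀ (by norm_num)]; nlinarith
    have hn2θ : (n : ℝ) ^ 2 * θ ≤ 1 / 9 := by
      have h3 : c ^ 2 ≤ 1 := by nlinarith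
      have := div_le_div_of_nonneg_right h3 (by norm_num : (0:ℝ) ≤ 9)
      linarith
    have hτ0r : 8 * (((n - 1 : ℕ) : ℝ)) * θ * (r : ℝ) ≤ c₁ := by
      -- `8(n−1)θ·r ≤ 8nθ·(n∕4) = 2n²θ ≤ 2c²∕9 ≤ c₁`
      have h1 : 8 * (((n - 1 : ℕ) : ℝ)) * θ ≤ 8 * (n : ℝ) * θ := by
        rw [hn1R]; exact mul_le_mul_of_nonneg_right (by linarith) hθ.le
      have h2 : 8 * (((n - 1 : ℕ) : ℝ)) * θ * (r : ℝ) ≤ 8 * (n : ℝ) * θ * r := mul_le_mul_of_nonneg_right h1 hr0.le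
      have h3 : 8 * (n : ℝ) * θ * r ≤ 2 * ((n : ℝ) ^ 2 * θ) := by
        have : θ * r ≤ θ * (n / 4) := mul_le_mul_of_nonneg_left (by linarith) hθ.le
        nlinarith
      nlinarith
    -- the energy row
    have hE7272 : ∑ y ∈ box z₀ (r : ℤ), ∑ μ : Fin 3, ‖τ μ y (u (y + unitVec μ)) - u y‖ ^ 2 ≤ 7272 * ((r : ℤ) : ℝ) := by
      refine hE'.trans ?_
      have hs4R : (n : ℝ) + 1 ≤ 4 * (((n / 2 - r - 3 : ℕ)) : ℝ) := by exact_mod_cast hs4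
      have := energy_row_le hn20R hs4R hr19R hr1R hθ.le hn2θ
      rw [hn1R]; push_cast; exact this
    -- the flat end-game (K-2b) at radius `r`
    have hR₁r : R₁ ≤ ((r : ℤ) : ℝ) := by
      push_cast; rw [hRbig_def] at hbig; linarith
    have hsq := hK2 u τ z₀ (r : ℤ) (8 * (((n - 1 : ℕ) : ℝ)) * θ) hR₁r hτ00 hu hdefect (by push_cast; exact hτ0r) hopt' hloc' hE7272 b.dir
    rw [← hbond] at hsq
    -- from the flat bond to the face
    have hrR' : ((r : ℤ) : ℝ)⁻¹ ≤ 24 / R' := by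
      push_cast
      rw [inv_eq_one_div, div_le_div_iff₀ hr0 hR'0]
      rw [hRbig_def] at hbig; linarith
    have hτθ : 8 * (((n - 1 : ℕ) : ℝ)) * θ ≤ 3 * (θ * R') := by
      rw [hn1R]
      have h1 : ((n : ℝ) - 1) * θ ≤ (R' / 3) * θ := mul_le_mul_of_nonneg_right (by linarith) hθ.le
      have h2 : 0 ≤ θ * R' := by positivity
      calc 8 * ((n : ℝ) - 1) * θ = 8 * (((n : ℝ) - 1) * θ) := by ring
        _ ≤ 8 * ((R' / 3) * θ) := mul_le_mul_of_nonneg_left h1 (by norm_num)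
        _ = (8 / 3) * (θ * R') := by ring
        _ ≤ 3 * (θ * R') := mul_le_mul_of_nonneg_right (by norm_num) h2
    have hX := face_of_bond_sq (norm_nonneg _) hΛf.le hR'0 hθ.le hτ00 hsq hrR' hτθ
    have hface := face_of_min_radius hθ hR0 hc0 hc1 hR'_def
    calc _ ≤ Real.sqrt (72 * Λf) * ((Real.sqrt R')⁻¹ + Real.sqrt θ * Real.sqrt R') := hX
      _ ≤ Real.sqrt (72 * Λf) * (((Real.sqrt c)⁻¹ + 1) * ((Real.sqrt R)⁻¹ + Real.sqrt θ * Real.sqrt R)) :=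
          mul_le_mul_of_nonneg_left hface (Real.sqrt_nonneg _)
      _ = (Real.sqrt (72 * Λf) * ((Real.sqrt c)⁻¹ + 1)) * ((Real.sqrt R)⁻¹ + Real.sqrt θ * Real.sqrt R) := by ring
      _ ≤ Λ * ((Real.sqrt R)⁻¹ + Real.sqrt θ * Real.sqrt R) := mul_le_mul_of_nonneg_right hΛa hface0
  · -- THE SMALL-BOX BRANCH
    push Not at hbig
    rw [hR'_def] at hbig
    exact htriv.trans (two_le_face_of_small hR0 hθ hc0 hRbig1 hΛ0.le hΛb hΛc hbig)

/-- ★★★ **THE K2 FACE FROM THE ORGAN ALONE**: the [C]-socket `hC` IS a tree theorem (★w5 g12 ✓p705854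
✓`PoincareLipschitzSphereMapOneStepHC.hOneStep_holds`, the E→R road F1–F5d closed by kernel), so `hImprove` (v1 899858e5) ⟹ `hRegH` (K2 face v2, 20ad198c VERBATIM).
[cite: Balaban1987RG1, (0.14) p.254; SchoenUhlenbeck1982, §4] -/
theorem hRegH_of_hImprove
    (hI : ∀ (Λ₀ ε₀ κ : ℝ), 0 < Λ₀ → 0 < ε₀ → 1 ≤ κ →
      ∃ (C₀ R₀ : ℝ), 1 ≤ C₀ ∧ 1 ≤ R₀ ∧
      ∀ (u : Zd 3 → EuclideanSpace ℝ (Fin 4)) (τ : Fin 3 → Zd 3 → (EuclideanSpace ℝ (Fin 4) ≃ₗᵢ[ℝ] EuclideanSpace ℝ (Fin 4)))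
      (z : Zd 3) (R : ℤ) (τ₀ : ℝ),
      R₀ ≤ R →
      (∀ y, ‖u y‖ = 1) →
      (∀ y ∈ box z (R + 1), ∀ (μ : Fin 3) (w : EuclideanSpace ℝ (Fin 4)), ‖τ μ y w - w‖ ≤ τ₀ * ‖w‖) →
      τ₀ * (R : ℝ) ≤ C₀⁻¹ →
      (∀ y ∈ box z R,
      ‖∑ μ : Fin 3, (τ μ y (u (y + unitVec μ)) + (τ μ (y - unitVec μ)).symm (u (y - unitVec μ)))‖ • u y =
      ∑ μ : Fin 3, (τ μ y (u (y + unitVec μ)) + (τ μ (y - unitVec μ)).symm (u (y - unitVec μ)))) →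
      (∀ (z' : Zd 3) (R' : ℤ), 0 ≤ R' → box z' (R' + 1) ⊆ box z R →
      ∀ v : Zd 3 → EuclideanSpace ℝ (Fin 4), (∀ y, y ∉ box z' R' → v y = u y) → (∀ y ∈ box z' R', ‖v y‖ = 1) →
      ∑ y ∈ box z' (R' + 1), ∑ μ : Fin 3, ‖τ μ y (u (y + unitVec μ)) - u y‖ ^ 2 ≤
      ∑ y ∈ box z' (R' + 1), ∑ μ : Fin 3, ‖τ μ y (v (y + unitVec μ)) - v y‖ ^ 2) →
      (∑ y ∈ box z R, ∑ μ : Fin 3, ‖τ μ y (u (y + unitVec μ)) - u y‖ ^ 2 ≤ Λ₀ * R) →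
      ∃ r : ℤ, 1 ≤ r ∧ (R : ℝ) ≤ C₀ * Real.log R ^ 6 * r ∧ κ * Real.log R ^ 6 * r ≤ R ∧
      box z (2 * r) ⊆ box z R ∧
      (∑ y ∈ box z (2 * r), ∑ μ : Fin 3, ‖τ μ y (u (y + unitVec μ)) - u y‖ ^ 2) * Real.log r ^ 6 ≤ ε₀ * r) :
    open Literature.MathematicalPhysics.QuantumFieldTheory.Balaban1983to89 Literature.MathematicalPhysics.QuantumFieldTheory.Balaban1983to89.T3ContinuumYM3Torus in ∀ (L : ℕ), ∃ Λ : ℝ, 0 < Λ ∧ ∀ (b₀ p₀ : ℝ), 0 < b₀ → 2 < p₀ → ∃ γ₃ : ℝ, 0 < γ₃ ∧ ∀ (F : T3Family) (γ : ℝ), F.L = L → 0 < γ → γ ≤ γ₃ → ∀ (K j : ℕ), 1 ≤ j → j + 3 ≤ K → ∀ (a : Plaq (F.P K) (j + 1)) (U U' : GaugeField (F.P K) 0 (Matrix.specialUnitaryGroup (Fin 2) ℂ)), (∀ (i : ℕ) (q : Plaq (F.P K) i), i < j + 1 → Site.tdist (fun k => ((((q.src k).val * F.L ^ i : ℕ))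 : ZMod ((F.P K).sitesPerDir 0))) (fun k => ((((a.src k).val * F.L ^ (j + 1) : ℕ)) : ZMod ((F.P K).sitesPerDir 0))) + 64 * F.L ^ i ≤ 64 * F.L ^ (j + 1) → GaugeGroup.dist1 (GaugeField.plaqHol (Averaging.iter (fun i' => BlockAveraging.blockAvg (P := F.P K) (j := i') T3UnitLawDensityEML.ℰp) i U) q) < T3UnitScaleTilt.θBal F.L γ b₀ p₀ (K - i)) → (∀ (i : ℕ) (q : Plaq (F.P K) i), i < j + 1 → Site.tdist (fun k => ((((q.src k).val * F.L ^ i : ℕ)) : ZMod ((F.P K).sitesPerDir 0))) (fun k => ((((a.src k).val * F.L ^ (j + 1) : ℕ)) : ZMod ((F.P K).sitesPerDir 0))) + 64 * F.L ^ i ≤ 64 * F.L ^ (j + 1) → GaugeGroup.dist1 (GaugeField.plaqHol (Averaging.iter (fun i' => BlockAveraging.blockAvg (P := F.P K) (j := i') T3UnitLawDensityEML.ℰp) i U') q) < T3UnitScaleTilt.θBal F.L γ b₀ p₀ (K - i)) → ∀ (i : ℕ), i < j → ∀ (M : ℕ) (h : GaugeTransf (F.P K) i (Matrix.specialUnitaryGroup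 (Fin 2) ℂ)), (∀ k' : GaugeTransf (F.P K) i (Matrix.specialUnitaryGroup (Fin 2) ℂ), (∑ b : PBond (F.P K) i, if b ∈ Finset.univ.filter (fun b : PBond (F.P K) i => Site.tdist (fun k => ((((b.src k).val * F.L ^ i : ℕ)) : ZMod ((F.P K).sitesPerDir 0))) (fun k => ((((a.src k).val * F.L ^ (j + 1) : ℕ)) : ZMod ((F.P K).sitesPerDir 0))) + 2 * F.L ^ (i + 1) + M ≤ 8 * F.L ^ (j + 1)) then GaugeGroup.dist1 (Averaging.iter (fun i' => BlockAveraging.blockAvg (P := F.P K) (j := i') T3UnitLawDensityEML.ℰp) i U b * (GaugeField.gaugeAct h (Averaging.iter (fun i' => BlockAveraging.blockAvg (P := F.P K) (j := i') T3UnitLawDensityEML.ℰp) i U') b)⁻¹) ^ 2 else 0) ≤ ∑ b : PBond (F.P K) i, if b ∈ Finset.univ.filter (fun b : PBond (F.P K) i => Site.tdist (fun k => ((((b.src k).val * F.L ^ i : ℕ)) : ZMod ((F.P K).sitesPerDir 0))) (fun k => ((((a.src k).val * F.L ^ (j + 1) : ℕ)) : ZMod ((F.P K).sitesPerDir 0)))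 + 2 * F.L ^ (i + 1) + M ≤ 8 * F.L ^ (j + 1)) then GaugeGroup.dist1 (Averaging.iter (fun i' => BlockAveraging.blockAvg (P := F.P K) (j := i') T3UnitLawDensityEML.ℰp) i U b * (GaugeField.gaugeAct k' (GaugeField.gaugeAct h (Averaging.iter (fun i' => BlockAveraging.blockAvg (P := F.P K) (j := i') T3UnitLawDensityEML.ℰp) i U')) b)⁻¹) ^ 2 else 0) → ∀ (b : PBond (F.P K) i) (R : ℝ), 1 ≤ R → ((Site.tdist (fun k => ((((b.src k).val * F.L ^ i : ℕ)) : ZMod ((F.P K).sitesPerDir 0))) (fun k => ((((a.src k).val * F.L ^ (j + 1) : ℕ)) : ZMod ((F.P K).sitesPerDir 0))) : ℕ) : ℝ) + R * (F.L : ℝ) ^ i + 2 * (F.L : ℝ) ^ (i + 1) + (M : ℝ) ≤ 8 * (F.L : ℝ) ^ (j + 1) → ‖BlockAveragingEMLLinearisedBackground.pertVar (Averaging.iter (fun i' => BlockAveraging.blockAvg (P := F.P K) (j := i') T3UnitLawDensityEML.ℰp) i U) (GaugeField.gaugeAct h (Averaging.iter (fun i' => BlockAveraging.blockAvg (P :=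 F.P K) (j := i') T3UnitLawDensityEML.ℰp) i U')) b‖ ≤ Λ * ((Real.sqrt R)⁻¹ + Real.sqrt (T3UnitScaleTilt.θBal F.L γ b₀ p₀ (K - i)) * Real.sqrt R) :=
  hRegH_of_hImprove_of_oneStep hI PoincareLipschitzSphereMapOneStepHC.hOneStep_holds

/-- ★★★ **THE ROUTE CRUX `BlockLipschitzL` (stmt-QuantumFields-23533) FROM THE ORGAN ALONE, BY NAME**: `hImprove` (v1 899858e5) ⟹
`Summit.QuantumFields.YangMills.Theses.PoincareLipschitz.BlockLipschitzL`, by ★w2 g11's face door ✓`blockLipschitzL_of_orbitMinHolderRegularity` (p700641) ∘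
`hRegH_of_hImprove`.  With ✓p700135 (`HistoryTailL ⟸ K1-exp ∧ BlockLipschitzL ∧ MeanDeviationL`) the crux `HistoryTailL` is thereby conditional on
{K1-exp, `hImprove`, `MeanDeviationL`} only. [cite: Balaban1987RG1, (0.14) p.254; SchoenUhlenbeck1982, Thm IV] -/
theorem blockLipschitzL_of_hImprove
    (hI : ∀ (Λ₀ ε₀ κ : ℝ), 0 < Λ₀ → 0 < ε₀ → 1 ≤ κ →
      ∃ (C₀ R₀ : ℝ), 1 ≤ C₀ ∧ 1 ≤ R₀ ∧
      ∀ (u : Zd 3 → EuclideanSpace ℝ (Fin 4)) (τ : Fin 3 → Zd 3 → (EuclideanSpace ℝ (Fin 4) ≃ₗᵢ[ℝ] EuclideanSpace ℝ (Fin 4)))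
      (z : Zd 3) (R : ℤ) (τ₀ : ℝ),
      R₀ ≤ R →
      (∀ y, ‖u y‖ = 1) →
      (∀ y ∈ box z (R + 1), ∀ (μ : Fin 3) (w : EuclideanSpace ℝ (Fin 4)), ‖τ μ y w - w‖ ≤ τ₀ * ‖w‖) →
      τ₀ * (R : ℝ) ≤ C₀⁻¹ →
      (∀ y ∈ box z R,
      ‖∑ μ : Fin 3, (τ μ y (u (y + unitVec μ)) + (τ μ (y - unitVec μ)).symm (u (y - unitVec μ)))‖ • u y =
      ∑ μ : Fin 3, (τ μ y (u (y + unitVec μ)) + (τ μ (y - unitVec μ)).symm (u (y - unitVec μ)))) →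
      (∀ (z' : Zd 3) (R' : ℤ), 0 ≤ R' → box z' (R' + 1) ⊆ box z R →
      ∀ v : Zd 3 → EuclideanSpace ℝ (Fin 4), (∀ y, y ∉ box z' R' → v y = u y) → (∀ y ∈ box z' R', ‖v y‖ = 1) →
      ∑ y ∈ box z' (R' + 1), ∑ μ : Fin 3, ‖τ μ y (u (y + unitVec μ)) - u y‖ ^ 2 ≤
      ∑ y ∈ box z' (R' + 1), ∑ μ : Fin 3, ‖τ μ y (v (y + unitVec μ)) - v y‖ ^ 2) →
      (∑ y ∈ box z R, ∑ μ : Fin 3, ‖τ μ y (u (y + unitVec μ)) - u y‖ ^ 2 ≤ Λ₀ * R) →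
      ∃ r : ℤ, 1 ≤ r ∧ (R : ℝ) ≤ C₀ * Real.log R ^ 6 * r ∧ κ * Real.log R ^ 6 * r ≤ R ∧
      box z (2 * r) ⊆ box z R ∧
      (∑ y ∈ box z (2 * r), ∑ μ : Fin 3, ‖τ μ y (u (y + unitVec μ)) - u y‖ ^ 2) * Real.log r ^ 6 ≤ ε₀ * r) :
    Summit.QuantumFields.YangMills.Theses.PoincareLipschitz.BlockLipschitzL :=
  blockLipschitzL_of_orbitMinHolderRegularity (hRegH_of_hImprove hI)

end Summit.QuantumFields.YangMills.Theorems.PoincareLipschitzOrbitMinHolderRegularityOfImprove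

end
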